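import Mathlib
import Summits.Ventures.PercRepro2.SepSplitGen

/-!
# Gluing at a general separator, VIII: ANY terminal set and ANY kernel of the terminal
connectivity — the domain Markov identity at a separator (blind cell PercRepro2, mine-2 g48,
2026-08-29; `conjectures/MINE-2.md` M2-98)

The five marks are replaced by an arbitrary finite family of TERMINALS `Z : ζ → V`, the kernel `K₃`
by any kernel `KZ` of the three copies' terminal connectivities (`connData`: the matrix
`Z k ↔ Z l`).  A split of the terminals across a separator `σ : ι → V` (`SepSplitT`, the terminal
form of `SepSplit`) determines every copy's terminal connectivity from the two side data
(`connData_eq_gluedT`, by the same closure lemmas), and sorting the copies by their far-side data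
gives the identity `typedCount_eq_sepSplitT`:
`typedCount F z τ (KZ ∘ connData) = (Σ_p farCount(p) · rootCount(p)) · (inert count)`.
The marks' identity is the case `ζ = Fin 5`, `KZ = KB ∘ (the seven coordinates)`
(`K3_eq_KZ_connData`).  The far-side kernel of a data triple is itself a kernel of the connectivity
of the terminals `S ∪ (far terminals)` — the identity iterates along nested separators (a tree
decomposition of the support contracts the typed count as a tensor network).  Own work; standard
axioms.
-/

namespace Summit.Ventures.PercRepro2

open UnionCluster

namespace CovForm

namespace RootBridge

open OneTyped TypedA3 Untouched TypedFactor Separated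

/-! ## Side data on a terminal set and the glued terminal connectivity -/

section StatesT

open Classical

variable {ι ζ : Type*}

/-- The data of one side of a copy at a separator indexed by `ι`, for the terminals `ζ`: the
connections inside the side among the terminals, from the separator vertices to the terminals, and
among the separator vertices. -/
abbrev SideDataT (ι ζ : Type*) := (ζ → ζ → Bool) × (ι → ζ → Bool) × (ι → ι → Bool)

/-- The glue relation read off the two side data. -/
def glueDT (h p : SideDataT ι ζ) (i j : ι) : Prop :=
  Relation.ReflTransGen (fun i j => h.2.2 i j = true ∨ p.2.2 i j = true) i j

/-- **The glued connection** between the terminals `k` and `l` from the root-side data `h`, the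
far-side data `p` and the side assignment. -/
def connT (h p : SideDataT ι ζ) (side : ζ → Bool) (k l : ζ) : Prop :=
  if side k = true then
    (if side l = true then
      p.1 k l = true ∨ ∃ i j, p.2.1 i k = true ∧ glueDT h p i j ∧ p.2.1 j l = true
    else ∃ i j, h.2.1 i l = true ∧ glueDT h p i j ∧ p.2.1 j k = true)
  else
    (if side l = true then ∃ i j, h.2.1 i k = true ∧ glueDT h p i j ∧ p.2.1 j l = true
    else h.1 k l = true ∨ ∃ i j, h.2.1 i k = true ∧ glueDT h p i j ∧ h.2.1 j l = true)

/-- **The glued terminal connectivity.** -/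
noncomputable def gluedT (h p : SideDataT ι ζ) (side : ζ → Bool) : ζ → ζ → Bool :=
  fun k l => decide (connT h p side k l)

/-- The exact-datum indicator. -/
noncomputable def exactT (p q : SideDataT ι ζ) : ℤ := if p = q then 1 else 0

/-- The indicator is nonnegative. -/
lemma exactT_nonneg (p q : SideDataT ι ζ) : 0 ≤ exactT p q := by
  unfold exactT
  split_ifs <;> simp

/-- A far-side data triple. -/
abbrev Pat3T (ι ζ : Type*) := SideDataT ι ζ × SideDataT ι ζ × SideDataT ι ζ

/-- Summing a function against the exact indicators of a data triple picks the triple. -/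
lemma sum_exactT [Fintype ι] [DecidableEq ι] [Fintype ζ] [DecidableEq ζ] (f : Pat3T ι ζ → ℤ)
    (q : Pat3T ι ζ) :
    (∑ p : Pat3T ι ζ, exactT p.1 q.1 * exactT p.2.1 q.2.1 * exactT p.2.2 q.2.2 * f p) = f q := by
  rw [Finset.sum_eq_single q]
  · simp [exactT]
  · intro p _ hpq
    by_cases h1 : p.1 = q.1
    · by_cases h2 : p.2.1 = q.2.1
      · by_cases h3 : p.2.2 = q.2.2
        · exact absurd (Prod.ext h1 (Prod.ext h2 h3)) hpq
        · simp [exactT, h3]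
      · simp [exactT, h2]
    · simp [exactT, h1]
  · intro h
    exact absurd (Finset.mem_univ q) h

end StatesT

/-! ## The class, the terminal connectivity of the support and the identity -/

section MainT

open Classical

variable {V : Type*} {E : Type*} {ι ζ : Type*} [Fintype E] [DecidableEq E] {R : Type*} [Field R]
variable (ends : E → Sym2 V) (Z : ζ → V) (σ : ι → V)

/-- The terminal connectivity of a configuration. -/
noncomputable def connData (y : Config E) : ζ → ζ → Bool :=
  fun k l => decide (Conn ends y (Z k) (Z l))

/-- The side data of a configuration on the terminals (read on a side's restriction). -/
noncomputable def sideDataT (y : Config E) : SideDataT ι ζ :=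
  (fun k l => decide (Conn ends y (Z k) (Z l)), fun i k => decide (Conn ends y (σ i) (Z k)),
    fun i j => decide (Conn ends y (σ i) (σ j)))

/-- **The terminals split across the separator `σ`**: the support graph `z ∪ F` splits into a root
side `VH` holding the terminals with `side k = false` and a far side `VL` holding those with
`side k = true`, the intersection covered by the separator vertices, no typed edge inside both
sides, the far-side terminals not separator vertices. -/
structure SepSplitT (side : ζ → Bool) (VL VH : Set V) (F : Finset E) (z : Config E) :
    Prop where
  split : ∀ e, zF F z e = true → e ∈ within ends VL ∨ e ∈ within ends VH
  cap : ∀ t, t ∈ VL → t ∈ VH → ∃ i, σ i = t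
  noloop : ∀ e ∈ F, ¬ (e ∈ within ends VL ∧ e ∈ within ends VH)
  rootH : ∀ k, side k = false → Z k ∈ VH
  farL : ∀ k, side k = true → Z k ∈ VL
  farsep : ∀ k, side k = true → ∀ i, σ i ≠ Z k

omit [Fintype E] in
/-- A configuration below `z ∪ F` has its open edges within a side. -/
lemma SepSplitT.split_of_le {side : ζ → Bool} {VL VH : Set V} {F : Finset E} {z : Config E}
    (h : SepSplitT ends Z σ side VL VH F z) {x : Config E} (hx : x ≤ zF F z) :
    ∀ e, x e = true → e ∈ within ends VL ∨ e ∈ within ends VH := fun e he =>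
  h.split e (by have := hx e; rw [he] at this; exact Bool.eq_true_of_true_le this)

omit [Fintype E] [DecidableEq E] in
/-- The glue relation of the sides is the glue relation of the two side data. -/
lemma glue_iff_glueDT (VL VH : Set V) (x : Config E) (i j : ι) :
    glue ends VH VL σ x i j ↔
      glueDT (sideDataT ends Z σ (withinRestr ends VH x))
        (sideDataT ends Z σ (withinRestr ends VL x)) i j := by
  unfold glue glueDT
  have hrel : sepStep ends VH VL σ x = fun i j =>
      (sideDataT ends Z σ (withinRestr ends VH x)).2.2 i j = true ∨
        (sideDataT ends Z σ (withinRestr ends VL x)).2.2 i j = true := by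
    funext i j
    simp only [sepStep, sideDataT, decide_eq_true_eq]
  rw [hrel]

omit [Fintype E] in
/-- **The glued connection is the connection**: for two terminals, the connection in a copy of the
support is the glued connection of its two side data. -/
theorem conn_iff_connT {side : ζ → Bool} {VL VH : Set V} {F : Finset E} {z : Config E}
    (h : SepSplitT ends Z σ side VL VH F z) {x : Config E} (hx : ∀ e, e ∉ F → x e = z e)
    (k l : ζ) :
    Conn ends x (Z k) (Z l) ↔
      connT (sideDataT ends Z σ (withinRestr ends VH x))
        (sideDataT ends Z σ (withinRestr ends VL x)) side k l := by
  have hsp := SepSplitT.split_of_le ends Z σ h (le_zF hx)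
  have hsp' : ∀ e, x e = true → e ∈ within ends VH ∨ e ∈ within ends VL := fun e he =>
    (hsp e he).symm
  have hcap' : ∀ t, t ∈ VH → t ∈ VL → ∃ i, σ i = t := fun t h1 h2 => h.cap t h2 h1
  have hg := glue_iff_glueDT ends Z σ VL VH x
  have hg' : ∀ i j, glue ends VL VH σ x i j ↔
      glueDT (sideDataT ends Z σ (withinRestr ends VH x))
        (sideDataT ends Z σ (withinRestr ends VL x)) i j := fun i j => by
    rw [glue_comm]
    exact hg i j
  unfold connT
  by_cases hk : side k = true
  · rw [if_pos hk]
    by_cases hl : side l = true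
    · rw [if_pos hl]
      rw [conn_sideG ends hsp h.cap (h.farL k hk) (h.farL l hl)]
      simp only [reachG, hg', sideDataT, decide_eq_true_eq]
    · rw [if_neg hl]
      have hl' : side l = false := by simpa using hl
      have e0 : Conn ends x (Z k) (Z l) ↔ Conn ends x (Z l) (Z k) := ⟨conn_symm, conn_symm⟩
      rw [e0, conn_crossG ends hsp' hcap' (h.rootH l hl') (h.farL k hk) (h.farsep k hk)]
      simp only [reachG', hg, sideDataT, decide_eq_true_eq]
  · rw [if_neg hk]
    have hk' : side k = false := by simpa using hk
    by_cases hl : side l = true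
    · rw [if_pos hl]
      rw [conn_crossG ends hsp' hcap' (h.rootH k hk') (h.farL l hl) (h.farsep l hl)]
      simp only [reachG', hg, sideDataT, decide_eq_true_eq]
    · rw [if_neg hl]
      have hl' : side l = false := by simpa using hl
      rw [conn_sideG ends hsp' hcap' (h.rootH k hk') (h.rootH l hl')]
      simp only [reachG, hg, sideDataT, decide_eq_true_eq]

omit [Fintype E] in
/-- **The terminal connectivity of a copy of the support**: the root-side data glued with the
far-side data. -/
theorem connData_eq_gluedT {side : ζ → Bool} {VL VH : Set V} {F : Finset E} {z : Config E}
    (h : SepSplitT ends Z σ side VL VH F z) {x : Config E} (hx : ∀ e, e ∉ F → x e = z e) :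
    connData ends Z x =
      gluedT (sideDataT ends Z σ (withinRestr ends VH x))
        (sideDataT ends Z σ (withinRestr ends VL x)) side := by
  funext k l
  unfold connData gluedT
  exact decide_eq_decide.mpr (conn_iff_connT ends Z σ h hx k l)

/-- The far-side kernel of the exact data triple `p`. -/
noncomputable def farKT (VL : Set V) (p : Pat3T ι ζ) : Config E → Config E → Config E → R :=
  fun x y w => ((exactT p.1 (sideDataT ends Z σ (withinRestr ends VL x)) *
    exactT p.2.1 (sideDataT ends Z σ (withinRestr ends VL y)) *
    exactT p.2.2 (sideDataT ends Z σ (withinRestr ends VL w)) : ℤ) : R)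

/-- The root-side kernel of a fixed far-side data triple `p` for the kernel `KZ` of the terminal
connectivities: `KZ` on the glued connectivities of the three copies. -/
noncomputable def rootKT (KZ : (ζ → ζ → Bool) → (ζ → ζ → Bool) → (ζ → ζ → Bool) → ℤ)
    (side : ζ → Bool) (VH : Set V) (p : Pat3T ι ζ) : Config E → Config E → Config E → R :=
  fun x y w => ((KZ (gluedT (sideDataT ends Z σ (withinRestr ends VH x)) p.1 side)
    (gluedT (sideDataT ends Z σ (withinRestr ends VH y)) p.2.1 side)
    (gluedT (sideDataT ends Z σ (withinRestr ends VH w)) p.2.2 side) : ℤ) : R)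

omit [Fintype E] in
/-- **A kernel of the terminal connectivities on the support**: the data-triple form. -/
theorem kernel_eq_sepSplitT [Fintype ι] [DecidableEq ι] [Fintype ζ] [DecidableEq ζ]
    (KZ : (ζ → ζ → Bool) → (ζ → ζ → Bool) → (ζ → ζ → Bool) → ℤ) {side : ζ → Bool}
    {VL VH : Set V} {F : Finset E} {z : Config E} (h : SepSplitT ends Z σ side VL VH F z)
    {x y w : Config E} (hx : ∀ e, e ∉ F → x e = z e) (hy : ∀ e, e ∉ F → y e = z e)
    (hw : ∀ e, e ∉ F → w e = z e) :
    ((KZ (connData ends Z x) (connData ends Z y) (connData ends Z w) : ℤ) : R) =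
      ∑ p : Pat3T ι ζ, farKT ends Z σ VL p (restr (sideF ends VL F) z x)
          (restr (sideF ends VL F) z y) (restr (sideF ends VL F) z w) *
        rootKT ends Z σ KZ side VH p (restr (sideF ends VH F) z x) (restr (sideF ends VH F) z y)
          (restr (sideF ends VH F) z w) := by
  rw [connData_eq_gluedT ends Z σ h hx, connData_eq_gluedT ends Z σ h hy,
    connData_eq_gluedT ends Z σ h hw]
  unfold farKT rootKT
  rw [withinRestr_restr_eq ends VH hx, withinRestr_restr_eq ends VH hy,
    withinRestr_restr_eq ends VH hw, withinRestr_restr_eq ends VL hx,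
    withinRestr_restr_eq ends VL hy, withinRestr_restr_eq ends VL hw]
  set hx' := sideDataT ends Z σ (withinRestr ends VH x) with hhx
  set hy' := sideDataT ends Z σ (withinRestr ends VH y) with hhy
  set hw' := sideDataT ends Z σ (withinRestr ends VH w) with hhw
  set qx := sideDataT ends Z σ (withinRestr ends VL x) with hqx
  set qy := sideDataT ends Z σ (withinRestr ends VL y) with hqy
  set qw := sideDataT ends Z σ (withinRestr ends VL w) with hqw
  have hs : (∑ p : Pat3T ι ζ, exactT p.1 qx * exactT p.2.1 qy * exactT p.2.2 qw *
      KZ (gluedT hx' p.1 side) (gluedT hy' p.2.1 side) (gluedT hw' p.2.2 side)) =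
      KZ (gluedT hx' qx side) (gluedT hy' qy side) (gluedT hw' qw side) :=
    sum_exactT (fun p : Pat3T ι ζ => KZ (gluedT hx' p.1 side) (gluedT hy' p.2.1 side)
      (gluedT hw' p.2.2 side)) (qx, qy, qw)
  rw [← hs]
  push_cast
  rfl

/-- **THE DOMAIN MARKOV IDENTITY AT A SEPARATOR, FOR ANY TERMINALS AND ANY KERNEL OF THEIR
CONNECTIVITY**: sorting the copies by their far-side data triple,
`typedCount F z τ (KZ ∘ connData) = (Σ_p farCount(p) · rootCount(p)) · (inert count)`. -/
theorem typedCount_eq_sepSplitT [Fintype ι] [DecidableEq ι] [Fintype ζ] [DecidableEq ζ]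
    (KZ : (ζ → ζ → Bool) → (ζ → ζ → Bool) → (ζ → ζ → Bool) → ℤ) {side : ζ → Bool}
    {VL VH : Set V} (F : Finset E) (z : Config E) (τ : E → ℕ)
    (h : SepSplitT ends Z σ side VL VH F z) :
    typedCount F z τ (fun x y w =>
        ((KZ (connData ends Z x) (connData ends Z y) (connData ends Z w) : ℤ) : R)) =
      (∑ p : Pat3T ι ζ, typedCount (sideF ends VL F) z τ (farKT ends Z σ VL p) *
          typedCount (sideF ends VH F) z τ (rootKT ends Z σ KZ side VH p)) *
        typedCount (F \ (sideF ends VL F ∪ sideF ends VH F)) z τ (fun _ _ _ => (1 : R)) := by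
  set A := sideF ends VL F with hA
  set B := sideF ends VH F with hB
  set C := F \ (A ∪ B) with hC
  have hAF : A ⊆ F := Finset.filter_subset _ _
  have hBF : B ⊆ F := Finset.filter_subset _ _
  have hAB : Disjoint A B := by
    rw [Finset.disjoint_left]
    intro e heA heB
    simp only [hA, hB, sideF, Finset.mem_filter] at heA heB
    exact h.noloop e heA.1 ⟨heA.2, heB.2⟩
  have hABF : A ∪ B ⊆ F := Finset.union_subset hAF hBF
  have hAC : Disjoint A C :=
    Finset.disjoint_of_subset_left Finset.subset_union_left Finset.disjoint_sdiff
  have hBC : Disjoint B C :=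
    Finset.disjoint_of_subset_left Finset.subset_union_right Finset.disjoint_sdiff
  have hF : A ∪ B ∪ C = F := Finset.union_sdiff_of_subset hABF
  have hker : typedCount F z τ (fun x y w =>
      ((KZ (connData ends Z x) (connData ends Z y) (connData ends Z w) : ℤ) : R)) =
      typedCount F z τ (fun x y w => ∑ p : Pat3T ι ζ,
        farKT ends Z σ VL p (restr A z x) (restr A z y) (restr A z w) *
          rootKT ends Z σ KZ side VH p (restr B z x) (restr B z y) (restr B z w)) := by
    refine typedCount_congr_on_support F z τ fun x y w hc _ => ?_
    exact kernel_eq_sepSplitT ends Z σ KZ h (fun e he => (hc e he).1)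
      (fun e he => (hc e he).2.1) (fun e he => (hc e he).2.2)
  have hm : ∀ p : Pat3T ι ζ, typedCount (A ∪ B ∪ C) z τ (fun x y w =>
      farKT ends Z σ VL p (restr A z x) (restr A z y) (restr A z w) *
        rootKT ends Z σ KZ side VH p (restr B z x) (restr B z y) (restr B z w)) =
      typedCount A z τ (farKT ends Z σ VL p) *
        typedCount B z τ (rootKT ends Z σ KZ side VH p) *
        typedCount C z τ (fun _ _ _ => (1 : R)) := fun p =>
    typedCount_mul_three A B C hAB hAC hBC z τ (farKT ends Z σ VL p)
      (rootKT ends Z σ KZ side VH p : Config E → Config E → Config E → R)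
  rw [hF] at hm
  rw [hker, typedCount_sum, Finset.sum_congr rfl (fun p _ => hm p), Finset.sum_mul]

end MainT

/-! ## The marks' kernel is a kernel of the terminal connectivity -/

section Marks

open Classical

variable {V : Type*} {E : Type*} {R : Type*} [Field R] (ends : E → Sym2 V) (mk : Fin 5 → V)

/-- The seven kernel coordinates read off a connectivity matrix of the five marks. -/
def st7 (c : Fin 5 → Fin 5 → Bool) : St :=
  (c 2 1, c 1 0, c 2 0, c 1 4, c 2 4, c 1 3, c 2 3)

omit [Field R] in
/-- The state is the seven coordinates of the terminal connectivity of the marks. -/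
lemma st_eq_st7_connData (x : Config E) :
    st ends (mk 0) (mk 1) (mk 2) (mk 3) (mk 4) x = st7 (connData ends mk x) := by
  unfold st st7 connData
  rfl

/-- **The marks' kernel `K₃` is `KB` of the seven coordinates of the terminal connectivity**: the
identity of `SepSplitGen` is the case `ζ = Fin 5` of the terminal identity. -/
lemma K3_eq_KZ_connData (x y w : Config E) :
    (K3 ends (mk 0) (mk 1) (mk 2) (mk 3) (mk 4) x y w : R) =
      ((KB (st7 (connData ends mk x)) (st7 (connData ends mk y)) (st7 (connData ends mk w)) :
        ℤ) : R) := by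
  rw [K3_eq_KB, st_eq_st7_connData, st_eq_st7_connData, st_eq_st7_connData]

end Marks

end RootBridge

end CovForm

end Summit.Ventures.PercRepro2
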